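import Mathlib
import Literature.NumberTheory.LFunctions.KatkovaPF44Proofs

/-!
# Exact trigonometric values at Pythagorean angles and a second-order enclosure of `cos(m(θ₀+δ))` (venture `DiscreteObjects`, target L)

Cell `pub-namedobj`, seat `pub-namedobj-mahler-g14`. Framing: lottery ticket; floor = certified bounds/negative
ranges.

Second primitive of the planned certificate checker for the auxiliary-function hypothesis (H) (rectangle form
`CensusAuxiliaryChebyshev.auxBound_of_uw`, variable `w = 2 cos θ`).  The checker works on `θ`-cells centred at PYTHAGOREAN angles
`θ₀ = 2 arctan t₀`, `t₀ ∈ ℚ`, where `cos θ₀ = (1 - t₀²)/(1 + t₀²)` and `sin θ₀ = 2t₀/(1 + t₀²)` are rational (`Literature.NumberTheory.LFunctions.cos_two_mul_arctan` (reused),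
`sin_two_mul_arctan`), so that all `cos mθ₀, sin mθ₀` are exact rationals by the recurrence `trigPair` (`trigPair_eq`); on a cell
`|θ - θ₀| ≤ h` with `m h ≤ 1` each harmonic is enclosed to second order:

  `|cos(m(θ₀+δ)) - (cos mθ₀ · (1 - (mδ)²/2) - sin mθ₀ · (mδ - (mδ)³/6))| ≤ (mh)⁴ · 5/48`   (`cos_harmonic_taylor`)

(Mathlib `Real.cos_bound`, `Real.sin_bound`).  Everything the kernel evaluates is over `ℚ`; the statements are over `ℝ`.
-/

namespace Summit.Ventures.DiscreteObjects.Mahler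

/-! ## Pythagorean angles -/

-- `cos(2 arctan t) = (1 - t²)/(1 + t²)` is `Literature.NumberTheory.LFunctions.cos_two_mul_arctan` (imported, reused).

/-- `sin(2 arctan t) = 2t/(1 + t²)`. -/
theorem sin_two_mul_arctan (t : ℝ) : Real.sin (2 * Real.arctan t) = 2 * t / (1 + t ^ 2) := by
  have h : 0 < 1 + t ^ 2 := by positivity
  rw [Real.sin_two_mul, Real.sin_arctan, Real.cos_arctan, mul_assoc, div_mul_div_comm, Real.mul_self_sqrt h.le]
  ring

/-! ## Harmonics by recurrence -/

/-- `(cos mθ, sin mθ)` from `(c, s) = (cos θ, sin θ)` by the Chebyshev recurrences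
`cos((m+2)θ) = 2c·cos((m+1)θ) - cos(mθ)`, `sin((m+2)θ) = 2c·sin((m+1)θ) - sin(mθ)` (computable over any ring). -/
def trigPair {R : Type*} [Ring R] (c s : R) : ℕ → R × R
  | 0 => (1, 0)
  | 1 => (c, s)
  | m + 2 => (2 * c * (trigPair c s (m + 1)).1 - (trigPair c s m).1, 2 * c * (trigPair c s (m + 1)).2 - (trigPair c s m).2)

/-- The recurrence computes `(cos mθ, sin mθ)`. -/
theorem trigPair_eq (θ : ℝ) : ∀ m : ℕ,
    trigPair (Real.cos θ) (Real.sin θ) m = (Real.cos (m * θ), Real.sin (m * θ))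
  | 0 => by simp [trigPair]
  | 1 => by simp [trigPair]
  | m + 2 => by
    rw [trigPair, trigPair_eq θ (m + 1), trigPair_eq θ m]
    have hc : Real.cos (((m + 2 : ℕ) : ℝ) * θ) = 2 * Real.cos θ * Real.cos (((m + 1 : ℕ) : ℝ) * θ) - Real.cos ((m : ℝ) * θ) := by
      have h1 : ((m + 2 : ℕ) : ℝ) * θ = ((m + 1 : ℕ) : ℝ) * θ + θ := by push_cast; ring
      have h2 : (m : ℝ) * θ = ((m + 1 : ℕ) : ℝ) * θ - θ := by push_cast; ring
      rw [h1, h2, Real.cos_add, Real.cos_sub]; ring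
    have hs : Real.sin (((m + 2 : ℕ) : ℝ) * θ) = 2 * Real.cos θ * Real.sin (((m + 1 : ℕ) : ℝ) * θ) - Real.sin ((m : ℝ) * θ) := by
      have h1 : ((m + 2 : ℕ) : ℝ) * θ = ((m + 1 : ℕ) : ℝ) * θ + θ := by push_cast; ring
      have h2 : (m : ℝ) * θ = ((m + 1 : ℕ) : ℝ) * θ - θ := by push_cast; ring
      rw [h1, h2, Real.sin_add, Real.sin_sub]; ring
    rw [hc, hs]

/-- `trigPair` commutes with ring homomorphisms (so the rational computation casts to the real one). -/
theorem map_trigPair {R S : Type*} [Ring R] [Ring S] (f : R →+* S) (c s : R) :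
    ∀ m : ℕ, f (trigPair c s m).1 = (trigPair (f c) (f s) m).1 ∧ f (trigPair c s m).2 = (trigPair (f c) (f s) m).2
  | 0 => by simp [trigPair]
  | 1 => by simp [trigPair]
  | m + 2 => by
    have h1 := map_trigPair f c s (m + 1)
    have h0 := map_trigPair f c s m
    simp only [trigPair]
    rw [map_sub, map_sub, map_mul, map_mul, map_mul, map_mul, h1.1, h1.2, h0.1, h0.2, map_ofNat]
    exact ⟨rfl, rfl⟩

/-- Exact harmonics at a Pythagorean angle: with `θ₀ = 2 arctan t₀` (`t₀ ∈ ℚ`),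
`(cos mθ₀, sin mθ₀) = trigPair ((1-t₀²)/(1+t₀²)) (2t₀/(1+t₀²)) m` computed in `ℚ`. -/
theorem trigPair_pythagorean (t₀ : ℚ) (m : ℕ) :
    Real.cos (m * (2 * Real.arctan t₀)) = (((trigPair ((1 - t₀ ^ 2) / (1 + t₀ ^ 2)) (2 * t₀ / (1 + t₀ ^ 2)) m).1 : ℚ) : ℝ) ∧
    Real.sin (m * (2 * Real.arctan t₀)) = (((trigPair ((1 - t₀ ^ 2) / (1 + t₀ ^ 2)) (2 * t₀ / (1 + t₀ ^ 2)) m).2 : ℚ) : ℝ) := by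
  have ht := trigPair_eq (2 * Real.arctan (t₀ : ℝ)) m
  rw [Literature.NumberTheory.LFunctions.cos_two_mul_arctan, sin_two_mul_arctan] at ht
  have hmap := map_trigPair (Rat.castHom ℝ) ((1 - t₀ ^ 2) / (1 + t₀ ^ 2)) (2 * t₀ / (1 + t₀ ^ 2)) m
  simp only [Rat.coe_castHom] at hmap
  have hc : (((1 - t₀ ^ 2) / (1 + t₀ ^ 2) : ℚ) : ℝ) = (1 - (t₀ : ℝ) ^ 2) / (1 + (t₀ : ℝ) ^ 2) := by push_cast; ring
  have hs : ((2 * t₀ / (1 + t₀ ^ 2) : ℚ) : ℝ) = 2 * (t₀ : ℝ) / (1 + (t₀ : ℝ) ^ 2) := by push_cast; ring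
  rw [hc, hs, ht] at hmap
  exact ⟨hmap.1.symm, hmap.2.symm⟩

/-! ## Second-order enclosure of one harmonic on a cell -/

/-- **`cos(m(θ₀+δ)) = cos mθ₀ · (1 - x²/2) - sin mθ₀ · (x - x³/6) + E`, `x = mδ`, `|E| ≤ (5/48)·(mh)⁴`** whenever `|δ| ≤ h` and
`m h ≤ 1` (from Mathlib's `Real.cos_bound`, `Real.sin_bound`). -/
theorem cos_harmonic_taylor (m : ℕ) (θ₀ δ h : ℝ) (hδ : |δ| ≤ h) (hmh : (m : ℝ) * h ≤ 1) :
    |Real.cos (m * (θ₀ + δ)) -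
        (Real.cos (m * θ₀) * (1 - (m * δ) ^ 2 / 2) - Real.sin (m * θ₀) * (m * δ - (m * δ) ^ 3 / 6))| ≤
      5 / 48 * ((m : ℝ) * h) ^ 4 := by
  set x : ℝ := m * δ with hx
  have hm0 : (0 : ℝ) ≤ m := Nat.cast_nonneg m
  have hh : 0 ≤ h := (abs_nonneg δ).trans hδ
  have hxabs : |x| ≤ (m : ℝ) * h := by
    rw [hx, abs_mul, abs_of_nonneg hm0]; exact mul_le_mul_of_nonneg_left hδ hm0
  have hx1 : |x| ≤ 1 := hxabs.trans hmh
  have hcos := Real.cos_bound hx1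
  have hsin := Real.sin_bound hx1
  have hadd : Real.cos (m * (θ₀ + δ)) = Real.cos (m * θ₀) * Real.cos x - Real.sin (m * θ₀) * Real.sin x := by
    rw [mul_add, Real.cos_add]
  rw [hadd]
  have key : Real.cos (↑m * θ₀) * Real.cos x - Real.sin (↑m * θ₀) * Real.sin x -
      (Real.cos (↑m * θ₀) * (1 - x ^ 2 / 2) - Real.sin (↑m * θ₀) * (x - x ^ 3 / 6)) =
      Real.cos (↑m * θ₀) * (Real.cos x - (1 - x ^ 2 / 2)) - Real.sin (↑m * θ₀) * (Real.sin x - (x - x ^ 3 / 6)) := by ring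
  rw [key]
  have hc1 : |Real.cos (↑m * θ₀)| ≤ 1 := Real.abs_cos_le_one _
  have hs1 : |Real.sin (↑m * θ₀)| ≤ 1 := Real.abs_sin_le_one _
  have hx4 : |x| ^ 4 ≤ ((m : ℝ) * h) ^ 4 := pow_le_pow_left₀ (abs_nonneg x) hxabs 4
  calc |Real.cos (↑m * θ₀) * (Real.cos x - (1 - x ^ 2 / 2)) - Real.sin (↑m * θ₀) * (Real.sin x - (x - x ^ 3 / 6))|
      ≤ |Real.cos (↑m * θ₀) * (Real.cos x - (1 - x ^ 2 / 2))| + |Real.sin (↑m * θ₀) * (Real.sin x - (x - x ^ 3 / 6))| :=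
        abs_sub _ _
    _ = |Real.cos (↑m * θ₀)| * |Real.cos x - (1 - x ^ 2 / 2)| + |Real.sin (↑m * θ₀)| * |Real.sin x - (x - x ^ 3 / 6)| := by
        rw [abs_mul, abs_mul]
    _ ≤ 1 * |Real.cos x - (1 - x ^ 2 / 2)| + 1 * |Real.sin x - (x - x ^ 3 / 6)| := by
        gcongr
    _ ≤ 5 / 48 * ((m : ℝ) * h) ^ 4 := by
        have hx5 : |x| ^ 5 ≤ |x| ^ 4 := by
          calc |x| ^ 5 = |x| ^ 4 * |x| := pow_succ _ _
            _ ≤ |x| ^ 4 * 1 := by gcongr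
            _ = |x| ^ 4 := mul_one _
        nlinarith [hx4, hx5, pow_nonneg (abs_nonneg x) 4, hcos, hsin]

/-- The same with the error as an interval: lower and upper rational-friendly bounds for `cos(m(θ₀+δ))`. -/
theorem cos_harmonic_mem_Icc (m : ℕ) (θ₀ δ h : ℝ) (hδ : |δ| ≤ h) (hmh : (m : ℝ) * h ≤ 1) :
    Real.cos (m * θ₀) * (1 - (m * δ) ^ 2 / 2) - Real.sin (m * θ₀) * (m * δ - (m * δ) ^ 3 / 6) - 5 / 48 * ((m : ℝ) * h) ^ 4 ≤
        Real.cos (m * (θ₀ + δ)) ∧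
      Real.cos (m * (θ₀ + δ)) ≤
        Real.cos (m * θ₀) * (1 - (m * δ) ^ 2 / 2) - Real.sin (m * θ₀) * (m * δ - (m * δ) ^ 3 / 6) + 5 / 48 * ((m : ℝ) * h) ^ 4 := by
  have h := abs_le.mp (cos_harmonic_taylor m θ₀ δ h hδ hmh)
  constructor <;> linarith [h.1, h.2]

end Summit.Ventures.DiscreteObjects.Mahler
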